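import Literature.Probability.RandomPlanarGeometry.TwoSidedWholePlaneSLEScaling
import Literature.Probability.RandomPlanarGeometry.TwoSidedWholePlaneSLEScalingLemmas
import Literature.Probability.RandomPlanarGeometry.WholePlaneSLEScaling
import HarnessLib

/-!
# Self-similarity of two-sided whole-plane SLE_κ (Zhan (2021), Cor. 4.7): the closure of the corrected class under dilations

Topic `Probability/RandomPlanarGeometry`; proofs file accompanying `TwoSidedWholePlaneSLEScaling`
(named fact `IsTwoSidedWholePlaneSLENatLawMeas.map_dilatePath`, the self-similarity half of
Zhan (2021), Cor. 4.7, over the measurably uniformized class of laws).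

Zhan's printed proof (arXiv version, p. 23): "The self-similarity of `γ̂₀` follows easily from the
scaling invariance of `ν^#_{∞⇌0}` and the scaling covariance of the Minkowski content measure."
Formally (`TwoSidedWholePlaneSLEScaling`, `map_dilatePath_of_unique_of_closed'`) this is
(closure) the dilate `D_a μ` of a corrected natural law `μ` is again one, plus (well-definedness)
two corrected natural laws coincide. This file PROVES the closure half on the probability space
carrying the two arms, modulo one boundary-regularity input isolated as an explicit hypothesis
(deterministic ingredients — Minkowski scaling covariance at the level of arms
`natParamClause_dilatePath`, the junk value of `extendFrom`, the countable Cauchy test, the trace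
spends no time interval on `ℝ` — are in `TwoSidedWholePlaneSLEScalingLemmas`):
* `IsTwoSidedWholePlaneSLEPairMeas.const_mul` — **the dilate of a measurably uniformized two-sided
  whole-plane SLE_κ pair is again one, on the same probability space**: the first arm by the scale
  covariance of whole-plane SLE_κ(2) modulo the capacity time shift
  (`IsWholePlaneSLEKappaRho.const_mul_comp_sub_log`), the second arm with the SAME driving Brownian
  path and a conjugated selector. The subtlety is the junk value of
  `ConformalEquiv.boundaryExtension = extendFrom` at points of `∂ℍ` where a uniformizer has no
  boundary value: that value is a fixed unspecified constant (`extendFrom_eq_choice_of_not_exists`)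
  and does not scale, so the naive conjugate `c · Φ(c⁻¹ η'(· - log c))` of the selector is not the
  boundary extension of the dilated uniformizer there. The selector used instead takes the value
  `c · Φ(c⁻¹ η'(· - log c))(x)` exactly where `Φ(c⁻¹ η'(· - log c))` passes a **countable Cauchy test
  along the rational points of `ℍ`** at `x` (`ratCauchy_of_tendsto`, `exists_tendsto_of_ratCauchy`:
  for functions continuous on `ℍ` this is equivalent to having a boundary value at `x`, and it is a
  measurable condition in `(η', x)`), and the junk constant elsewhere; it is jointly measurable and
  agrees on the whole closed half-plane with the boundary extension of the dilated uniformizer. What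
  remains is that the chordal trace only visits points where the uniformizer HAS a boundary value:
  granted that every normalised uniformizer of the remaining domain has at every point of the closed
  half-plane a limit in the sphere (hypothesis `hsph`), the alternative — limit `∞` at a visited
  point — is excluded because the trace spends no time interval on `ℝ`
  (`Loewner.IsGeneratedByCurve.mem_closure_setOf_mem_upperHalfPlaneSet`, from the strict growth of
  the hulls, `Loewner.hull_ssubset_hull`) while the second arm `η₂ = φ ∘ trace` is continuous.
* `isTwoSidedWholePlaneSLENatLawMeas_map_dilatePath_of_boundaryLimits` — hence the dilate
  `(dilatePath (1/d) a)_* μ` of a corrected natural law represented on such a space is a corrected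
  natural law. The class-level consequences (the closure hypothesis `hcl` of
  `map_dilatePath_of_unique_of_closed` modulo the continuity theorem for conformal maps onto
  complements of curves from `∞` to `0`, and the named fact from it and well-definedness) are in
  `TwoSidedWholePlaneSLEScalingReduction`.

What is NOT here (the two remaining inputs, both absent from the tree). (1) `hsph`: almost surely,
every conformal map `φ : ℍ → Ĉ(η₁; ∞)` onto the remaining domain of the first arm with `φ(0) = 0`,
`φ(∞) = ∞` has at every point of the closed half-plane a limit in the Riemann sphere — the
continuity theorem for conformal maps onto domains with locally connected boundary (Pommerenke
(1992), Thm 2.1; the tree has the bounded "cover" form `ConformalEquiv.continuousOn_extendFrom_of_cover`)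
for the UNBOUNDED domain `Ĉ(η₁; ∞)` (Koebe square-root trick and a Möbius inversion, cf. the support
files `Literature.Topology.PlaneTopology.SquareRootContinua`, `…HalfLineCurves`), with the local
connectivity of `{0} ∪ η₁ ∪ {∞}` (a curve: `η₁` is continuous, `→ 0` at `+∞` and `→ ∞` at `-∞`).
(2) `hu`: the well-definedness of the corrected law — uniqueness in law of whole-plane SLE_κ(2) as
defined by `IsWholePlaneSLEKappaRho` (a measurable whole-plane trace functional of the driving
process), independence of the conditional law of the second arm from the measurable selector
(uniqueness of the accesses at the tip `0` and at `∞`), and the transfer to the Minkowski content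
parametrisation across probability spaces.

## References

* D. Zhan, *SLE loop measures*, PTRF 179 (2021), arXiv:1702.08026 (arXiv numbering): §2.1–2.2,
  Cor. 4.7 and its proof (p. 23). [Zhan2021SLELoopMeasures]
* Ch. Pommerenke, *Boundary Behaviour of Conformal Maps* (1992), Thm 2.1. [PommerenkeBBCM1992]
* G. F. Lawler, *Conformally Invariant Processes in the Plane*, AMS (2005), Ch. 4 §4.1 (hulls
  generated by a curve). [Lawler2005]
-/

noncomputable section

open Set Filter Topology MeasureTheory ProbabilityTheory Complex
open UpperHalfPlane (upperHalfPlaneSet)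
open scoped NNReal Real ENNReal

namespace Literature.Probability.RandomPlanarGeometry

open scoped PathBorel

/-! ### The dilate of a measurably uniformized pair, on the same probability space -/

section PairDilation

variable {Ω : Type*} [MeasurableSpace Ω]

/-- **Dilation covariance of measurably uniformized two-sided whole-plane SLE_κ pairs** (same
probability space). Let `(η₁, η₂)` be a two-sided whole-plane SLE_κ pair with measurable uniformizer
selector (`IsTwoSidedWholePlaneSLEPairMeas`) whose second arm is almost surely continuous, and suppose
that almost surely every normalised uniformizer `φ : ℍ → Ĉ(η₁; ∞)` of the remaining domain of the
first arm (boundary value `0` at `0`, `∞` at `∞`) has, at every point of the closed half-plane, a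
limit IN THE SPHERE — a boundary value in `ℂ` or the limit `∞` (hypothesis `hsph`: the continuity
theorem for conformal maps onto domains with locally connected boundary, Pommerenke (1992), Thm 2.1,
for this unbounded domain; NOT in the tree). Then for every `c > 0` the dilated arms
`(c η₁(· + log c), c η₂)` form again such a pair on the same space.
First arm: whole-plane SLE_κ(2) from `0` to `∞` is scale invariant modulo the capacity time shift
(`IsWholePlaneSLEKappaRho.const_mul_comp_sub_log`, applied with `c⁻¹` to `γ₁ = 1/η₁`). Second arm: same
driving Brownian path, and the conjugated selector `Φ'(η')(x) = c · Φ(c⁻¹ η'(· - log c))(x)` at the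
points `x` where `Φ(c⁻¹ η'(· - log c))` passes the countable Cauchy test along rational points of `ℍ`
(`exists_tendsto_of_ratCauchy`, a measurable condition), and the junk constant of `extendFrom`
elsewhere (`extendFrom_eq_choice_of_not_exists`); it is jointly measurable, and its value at the
dilated first arm agrees on the WHOLE closed half-plane with the boundary extension of the dilated
uniformizer `c φ : ℍ → c · Ĉ(η₁; ∞) = Ĉ(c η₁(· + log c); ∞)` (`armComplement_const_mul_comp_sub`) —
`c` times the boundary value where `φ` has one, the junk constant where it has none. The second-arm
identity `c η₂ = Φ'(first arm) ∘ (SLE_κ trace)` then needs a (finite) boundary value of `φ` at every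
point the trace visits: by `hsph` the only alternative is the limit `∞` there, which is excluded
because the trace spends no time interval on `ℝ`
(`Loewner.IsGeneratedByCurve.mem_closure_setOf_mem_upperHalfPlaneSet`), so that `η₂ = φ ∘ trace`
would be unbounded near that time, against the continuity of `η₂`. Zhan (2021), §2.2 and the proof
of Cor. 4.7 ("the scaling invariance of `ν^#_{∞⇌0}`"). [cite: Zhan2021SLELoopMeasures, §2.2 / Cor. 4.7 (proof)] -/
theorem IsTwoSidedWholePlaneSLEPairMeas.const_mul {κ : ℝ≥0} {P : Measure Ω} {η₁ : Ω → ℝ → ℂ}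
    {η₂ : Ω → ℝ≥0 → ℂ} (h : IsTwoSidedWholePlaneSLEPairMeas κ P η₁ η₂)
    (hcont : ∀ᵐ ω ∂P, Continuous (η₂ ω))
    (hsph : ∀ᵐ ω ∂P, ∀ φ : ConformalEquiv upperHalfPlaneSet (armComplement (η₁ ω)),
      φ.HasBoundaryValue 0 0 → Tendsto φ (cocompact ℂ ⊓ 𝓟 upperHalfPlaneSet) (cocompact ℂ) →
        ∀ x ∈ closure upperHalfPlaneSet, (∃ y, Tendsto φ (𝓝[upperHalfPlaneSet] x) (𝓝 y)) ∨
          Tendsto φ (𝓝[upperHalfPlaneSet] x) (cocompact ℂ))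
    {c : ℝ} (hc : 0 < c) :
    IsTwoSidedWholePlaneSLEPairMeas κ P (fun ω t ↦ (c : ℂ) * η₁ ω (t + Real.log c))
      (fun ω t ↦ (c : ℂ) * η₂ ω t) := by
  classical
  obtain ⟨⟨γ₁, hγ₁, hη₁⟩, hmeas₂, W, Φ, hW, hΦ, hlawW, hind, hae⟩ := h
  set k : ℂ := (c : ℂ) with hk_def
  have hk : k ≠ 0 := ofReal_ne_zero.2 hc.ne'
  -- undoing the dilation of a first-arm path: `T η' = k⁻¹ η'(· - log c)`
  let T : (ℝ → ℂ) → (ℝ → ℂ) := fun η' u ↦ k⁻¹ * η' (u - Real.log c)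
  have hT : Measurable T :=
    measurable_pi_lambda _ fun u ↦ (measurable_pi_apply (u - Real.log c)).const_mul _
  -- the countable Cauchy test along rational points of `ℍ`, a measurable set of `(η', x)`
  let E : Set ((ℝ → ℂ) × ℂ) := {p | ∀ n : ℕ, ∃ m : ℕ, ∀ q q' : ℚ × ℚ, 0 < q.2 → 0 < q'.2 →
    dist (⟨(q.1 : ℝ), (q.2 : ℝ)⟩ : ℂ) p.2 < 1 / ((m : ℝ) + 1) →
      dist (⟨(q'.1 : ℝ), (q'.2 : ℝ)⟩ : ℂ) p.2 < 1 / ((m : ℝ) + 1) →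
        dist (Φ (T p.1) ⟨(q.1 : ℝ), (q.2 : ℝ)⟩) (Φ (T p.1) ⟨(q'.1 : ℝ), (q'.2 : ℝ)⟩) ≤
          1 / ((n : ℝ) + 1)}
  have hΦq : ∀ q : ℚ × ℚ, Measurable fun p : (ℝ → ℂ) × ℂ ↦ Φ (T p.1) ⟨(q.1 : ℝ), (q.2 : ℝ)⟩ :=
    fun q ↦ hΦ.comp ((hT.comp measurable_fst).prodMk measurable_const)
  have hE : MeasurableSet E := by
    refine measurableSet_setOf.2 <| Measurable.forall fun n ↦ Measurable.exists fun m ↦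
      Measurable.forall fun q ↦ Measurable.forall fun q' ↦ measurable_const.imp <|
        measurable_const.imp <| Measurable.imp ?_ <| Measurable.imp ?_ ?_
    · exact measurableSet_setOf.1 (measurableSet_lt (measurable_const.dist measurable_snd)
        measurable_const)
    · exact measurableSet_setOf.1 (measurableSet_lt (measurable_const.dist measurable_snd)
        measurable_const)
    · exact measurableSet_setOf.1 (measurableSet_le ((hΦq q).dist (hΦq q')) measurable_const)
  -- the conjugated selector: `c Φ(T η')` where the Cauchy test passes, the junk constant elsewhere
  let J : ℂ := Classical.choice ⟨0⟩
  let Φ' : (ℝ → ℂ) → ℂ → ℂ := fun η' x ↦ E.piecewise (fun p ↦ k * Φ (T p.1) p.2) (fun _ ↦ J) (η', x)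
  refine ⟨?_, fun t ↦ (hmeas₂ t).const_mul _, W, Φ', hW, ?_, hlawW, ?_, ?_⟩
  · -- the first arm: `c η₁(· + log c) = 1 / (c⁻¹ γ₁(· - log c⁻¹))`
    refine ⟨fun ω t ↦ ((c⁻¹ : ℝ) : ℂ) * γ₁ ω (t - Real.log c⁻¹),
      hγ₁.const_mul_comp_sub_log (inv_pos.2 hc), fun ω t ↦ ?_⟩
    change k * η₁ ω (t + Real.log c) = (((c⁻¹ : ℝ) : ℂ) * γ₁ ω (t - Real.log c⁻¹))⁻¹
    rw [Real.log_inv, sub_neg_eq_add, hη₁, mul_inv, ofReal_inv, inv_inv]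
  · -- joint measurability of the conjugated selector
    change Measurable (E.piecewise (fun p ↦ k * Φ (T p.1) p.2) fun _ ↦ J)
    exact Measurable.piecewise hE ((hΦ.comp ((hT.comp measurable_fst).prodMk measurable_snd)).const_mul k)
      measurable_const
  · -- independence: the new first arm is a measurable function of the old one
    have hF : Measurable fun η' : ℝ → ℂ ↦ fun t ↦ k * η' (t + Real.log c) :=
      measurable_pi_lambda _ fun t ↦ (measurable_pi_apply (t + Real.log c)).const_mul _
    exact hind.comp hF measurable_id
  · -- the almost-sure clause
    filter_upwards [hae, hcont, hsph] with ω ⟨hunif, hgen, hη₂⟩ hcontω hsphω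
    set η₁' : ℝ → ℂ := fun t ↦ k * η₁ ω (t + Real.log c) with hη₁'
    have hTη : T η₁' = η₁ ω := by
      funext u
      change k⁻¹ * (k * η₁ ω (u - Real.log c + Real.log c)) = η₁ ω u
      rw [sub_add_cancel, inv_mul_cancel_left₀ hk]
    obtain ⟨φ, h0, hinf, heq⟩ := hunif
    -- `f = Φ(η₁)` is the boundary extension of `φ`; it is continuous on `ℍ` and agrees with `φ` there
    set f : ℂ → ℂ := Φ (η₁ ω) with hf_def
    have hfφ : EqOn f φ upperHalfPlaneSet := fun z hz ↦
      (heq (subset_closure hz)).trans (φ.boundaryExtension_eq hz)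
    have hfc : ContinuousOn f upperHalfPlaneSet := φ.continuousOn.congr hfφ
    have hfiff : ∀ {x : ℂ} {l : Filter ℂ},
        Tendsto f (𝓝[upperHalfPlaneSet] x) l ↔ Tendsto φ (𝓝[upperHalfPlaneSet] x) l :=
      fun {x l} ↦ tendsto_congr' (eventuallyEq_of_mem self_mem_nhdsWithin hfφ)
    -- membership in `E` of `(η₁', x)` is the Cauchy test for `f` at `x`
    have hEiff : ∀ x : ℂ, (η₁', x) ∈ E ↔ ∀ n : ℕ, ∃ m : ℕ, ∀ q q' : ℚ × ℚ, 0 < q.2 → 0 < q'.2 →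
        dist (⟨(q.1 : ℝ), (q.2 : ℝ)⟩ : ℂ) x < 1 / ((m : ℝ) + 1) →
          dist (⟨(q'.1 : ℝ), (q'.2 : ℝ)⟩ : ℂ) x < 1 / ((m : ℝ) + 1) →
            dist (f ⟨(q.1 : ℝ), (q.2 : ℝ)⟩) (f ⟨(q'.1 : ℝ), (q'.2 : ℝ)⟩) ≤ 1 / ((n : ℝ) + 1) := by
      intro x
      simp only [E, mem_setOf_eq, hTη, hf_def]
    -- hence, for `x` in the closed half-plane: `(η₁', x) ∈ E` iff `φ` has a boundary value at `x`
    have hE_of_tendsto : ∀ {x y : ℂ}, Tendsto φ (𝓝[upperHalfPlaneSet] x) (𝓝 y) → (η₁', x) ∈ E :=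
      fun {x y} hy ↦ (hEiff x).2 (ratCauchy_of_tendsto (hfiff.2 hy))
    have htendsto_of_E : ∀ {x : ℂ}, x ∈ closure upperHalfPlaneSet → (η₁', x) ∈ E →
        ∃ y, Tendsto φ (𝓝[upperHalfPlaneSet] x) (𝓝 y) := fun {x} hx hxE ↦ by
      obtain ⟨y, hy⟩ := exists_tendsto_of_ratCauchy hfc hx ((hEiff x).1 hxE)
      exact ⟨y, hfiff.1 hy⟩
    -- values of the conjugated selector at the dilated first arm
    have hΦ'_mem : ∀ {x : ℂ}, (η₁', x) ∈ E → Φ' η₁' x = k * f x := fun {x} hx ↦ by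
      change E.piecewise (fun p ↦ k * Φ (T p.1) p.2) (fun _ ↦ J) (η₁', x) = k * f x
      rw [piecewise_eq_of_mem _ _ _ hx]
      change k * Φ (T η₁') x = k * Φ (η₁ ω) x
      rw [hTη]
    have hΦ'_nmem : ∀ {x : ℂ}, (η₁', x) ∉ E → Φ' η₁' x = J := fun {x} hx ↦ by
      change E.piecewise (fun p ↦ k * Φ (T p.1) p.2) (fun _ ↦ J) (η₁', x) = J
      rw [piecewise_eq_of_notMem _ _ _ hx]
    -- the trace visits only points where `φ` has a (finite) boundary value
    have htrace : ∀ t, ∃ y, Tendsto φ (𝓝[upperHalfPlaneSet] (sleTrace κ (W ω) t)) (𝓝 y) := by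
      intro t
      set x : ℂ := sleTrace κ (W ω) t with hx_def
      have hx : x ∈ closure upperHalfPlaneSet := by
        rw [show upperHalfPlaneSet = {z : ℂ | 0 < z.im} from rfl, Complex.closure_setOf_lt_im]
        exact hgen.im_nonneg t
      refine (hsphω φ h0 hinf x hx).resolve_right fun hcc ↦ ?_
      -- times at which the trace is in the open half-plane accumulate at `t`
      set U : Set ℝ≥0 := {s | sleTrace κ (W ω) s ∈ upperHalfPlaneSet} with hU
      have htU : t ∈ closure U :=
        hgen.mem_closure_setOf_mem_upperHalfPlaneSet (continuous_sleDriving κ (W ω)) t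
      haveI : NeBot (𝓝[U] t) := mem_closure_iff_nhdsWithin_neBot.1 htU
      have hτ : Tendsto (sleTrace κ (W ω)) (𝓝[U] t) (𝓝[upperHalfPlaneSet] x) :=
        tendsto_nhdsWithin_iff.2 ⟨(hgen.continuous.tendsto t).mono_left nhdsWithin_le_nhds,
          eventually_of_mem self_mem_nhdsWithin fun s hs ↦ hs⟩
      -- along those times `η₂ = φ ∘ trace → ∞`, against the continuity of `η₂` at `t`
      have h1 : Tendsto (η₂ ω) (𝓝[U] t) (cocompact ℂ) := by
        refine (hcc.comp hτ).congr' ?_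
        filter_upwards [self_mem_nhdsWithin] with s hs
        change φ (sleTrace κ (W ω) s) = η₂ ω s
        rw [hη₂ s, ← hfφ hs]
      have h2 : Tendsto (η₂ ω) (𝓝[U] t) (𝓝 (η₂ ω t)) :=
        (hcontω.tendsto t).mono_left nhdsWithin_le_nhds
      exact h2.not_tendsto (disjoint_nhds_cocompact (η₂ ω t)) h1
    refine ⟨?_, hgen, fun t ↦ ?_⟩
    · -- `Φ' η₁'` is the boundary extension of the dilated uniformizer `c φ`
      have hdom : armComplement η₁' = (fun z ↦ k * z) '' armComplement (η₁ ω) := by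
        have : η₁' = fun t ↦ k * η₁ ω (t - -Real.log c) := by
          funext t
          rw [hη₁', sub_neg_eq_add]
        rw [this]
        exact armComplement_const_mul_comp_sub hk (η₁ ω) _
      let φ' : ConformalEquiv upperHalfPlaneSet (armComplement η₁') :=
        { toFun := fun z ↦ k * φ z
          invFun := fun w ↦ φ.symm (k⁻¹ * w)
          source := upperHalfPlaneSet
          target := armComplement η₁'
          map_source' := fun z hz ↦ by
            rw [hdom]
            exact mem_image_of_mem _ (φ.mapsTo hz)
          map_target' := fun w hw ↦ by
            rw [hdom] at hw
            obtain ⟨v, hv, rfl⟩ := hw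
            change φ.symm (k⁻¹ * (k * v)) ∈ upperHalfPlaneSet
            rw [inv_mul_cancel_left₀ hk]
            exact φ.symm_mapsTo hv
          left_inv' := fun z hz ↦ by
            rw [inv_mul_cancel_left₀ hk, φ.symm_apply_apply hz]
          right_inv' := fun w hw ↦ by
            rw [hdom] at hw
            obtain ⟨v, hv, rfl⟩ := hw
            change k * φ (φ.symm (k⁻¹ * (k * v))) = k * v
            rw [inv_mul_cancel_left₀ hk, φ.apply_symm_apply hv]
          source_eq := rfl
          target_eq := rfl
          differentiableOn := φ.differentiableOn_coe.const_mul k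
          differentiableOn_symm := by
            change DifferentiableOn ℂ (fun w ↦ φ.symm (k⁻¹ * w)) (armComplement η₁')
            rw [hdom]
            refine φ.symm.differentiableOn_coe.comp (differentiableOn_id.const_mul k⁻¹) ?_
            rintro _ ⟨v, hv, rfl⟩
            change k⁻¹ * (k * v) ∈ armComplement (η₁ ω)
            rwa [inv_mul_cancel_left₀ hk] }
      refine ⟨φ', ?_, ?_, fun x hx ↦ ?_⟩
      · -- boundary value `0` at `0`
        change Tendsto (fun z ↦ k * φ z) (𝓝[upperHalfPlaneSet] 0) (𝓝 0)
        simpa using h0.const_mul k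
      · -- `∞ ↦ ∞`
        change Tendsto (fun z ↦ k * φ z) (cocompact ℂ ⊓ 𝓟 upperHalfPlaneSet) (cocompact ℂ)
        exact (Filter.tendsto_cocompact_mul_left₀ hk).comp hinf
      · -- agreement with the boundary extension on the closed half-plane
        by_cases hxE : (η₁', x) ∈ E
        · obtain ⟨y, hy⟩ := htendsto_of_E hx hxE
          have hy' : φ'.HasBoundaryValue x (k * y) := by
            change Tendsto (fun z ↦ k * φ z) (𝓝[upperHalfPlaneSet] x) (𝓝 (k * y))
            exact hy.const_mul k
          rw [hΦ'_mem hxE, heq hx, φ.boundaryExtension_eq_of_hasBoundaryValue hx hy,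
            φ'.boundaryExtension_eq_of_hasBoundaryValue hx hy']
        · have hno : ¬ ∃ y, Tendsto φ (𝓝[upperHalfPlaneSet] x) (𝓝 y) :=
            fun ⟨y, hy⟩ ↦ hxE (hE_of_tendsto hy)
          have hno' : ¬ ∃ y, Tendsto (fun z ↦ k * φ z) (𝓝[upperHalfPlaneSet] x) (𝓝 y) := by
            rintro ⟨y, hy⟩
            refine hno ⟨k⁻¹ * y, ?_⟩
            have := hy.const_mul k⁻¹
            simpa only [inv_mul_cancel_left₀ hk] using this
          rw [hΦ'_nmem hxE]
          exact (extendFrom_eq_choice_of_not_exists hno').symm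
    · -- the second arm: the trace visits only points of `E`
      obtain ⟨y, hy⟩ := htrace t
      rw [hΦ'_mem (hE_of_tendsto hy), hη₂ t]

end PairDilation

/-! ### Closure of the corrected class under dilations, and the named fact, modulo boundary regularity -/

section Closure

/-- **The dilate of a corrected natural law with boundary-regular first arm is a corrected natural
law.** On a probability space carrying a measurably uniformized two-sided whole-plane SLE_κ pair
`(η₁, η₂)` whose remaining domain `Ĉ(η₁; ∞)` is almost surely boundary regular in the sphere
(hypothesis `hsph` of `IsTwoSidedWholePlaneSLEPairMeas.const_mul`) and its Minkowski content
parametrisation `γ̂` rooted at `0`, the dilate `D_a γ̂` (`a > 0`, index `ν = 1/d`, `d = 1 + κ/8`) is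
the Minkowski content parametrisation rooted at `0` of the dilated pair (`natParamClause_dilatePath`
with `a^ν = c`, `IsTwoSidedWholePlaneSLEPairMeas.const_mul`; the second arm `η₂ = γ̂ ∘ e⁻¹` on `[0, ∞)`
is continuous), so its law `(dilatePath (1/d) a)_* (γ̂_* P)` is a corrected natural law. This is the
closure of the corrected class under the dilations — "the scaling invariance of `ν^#_{∞⇌0}` and the
scaling covariance of the Minkowski content measure" of the proof of Zhan (2021), Cor. 4.7 — modulo
boundary regularity. [cite: Zhan2021SLELoopMeasures, Cor. 4.7 (proof)] -/
theorem isTwoSidedWholePlaneSLENatLawMeas_map_dilatePath_of_boundaryLimits {κ : ℝ≥0}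
    {Ω : Type} [MeasurableSpace Ω] {P : Measure Ω} {η₁ : Ω → ℝ → ℂ} {η₂ : Ω → ℝ≥0 → ℂ}
    {γ : Ω → C(ℝ, ℂ)} (hpair : IsTwoSidedWholePlaneSLEPairMeas κ P η₁ η₂) (hγ : Measurable γ)
    (hae : ∀ᵐ ω ∂P, IsNaturallyParametrized (1 + (κ : ℝ) / 8) (γ ω) ∧ γ ω 0 = 0 ∧
        (∃ e : ℝ≥0 ≃o ℝ≥0, ∀ t : ℝ≥0, γ ω t = η₂ ω (e t)) ∧
        (∃ e' : Iio (0 : ℝ) ≃o ℝ, ∀ t : Iio (0 : ℝ), γ ω t = η₁ ω (e' t)))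
    (hsph : ∀ᵐ ω ∂P, ∀ φ : ConformalEquiv upperHalfPlaneSet (armComplement (η₁ ω)),
      φ.HasBoundaryValue 0 0 → Tendsto φ (cocompact ℂ ⊓ 𝓟 upperHalfPlaneSet) (cocompact ℂ) →
        ∀ x ∈ closure upperHalfPlaneSet, (∃ y, Tendsto φ (𝓝[upperHalfPlaneSet] x) (𝓝 y)) ∨
          Tendsto φ (𝓝[upperHalfPlaneSet] x) (cocompact ℂ))
    {a : ℝ} (ha : 0 < a) :
    IsTwoSidedWholePlaneSLENatLawMeas κ ((P.map γ).map (dilatePath (1 / (1 + (κ : ℝ) / 8)) a)) := by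
  set ν : ℝ := 1 / (1 + (κ : ℝ) / 8) with hν
  have hd : (0 : ℝ) < 1 + (κ : ℝ) / 8 := by positivity
  have hνd : ν * (1 + (κ : ℝ) / 8) = 1 := by
    rw [hν, one_div, inv_mul_cancel₀ hd.ne']
  set c : ℝ := a ^ ν with hc_def
  have hc : 0 < c := Real.rpow_pos_of_pos ha ν
  -- the second arm is continuous: `η₂ = γ̂ ∘ e⁻¹` on `[0, ∞)`
  have hcont : ∀ᵐ ω ∂P, Continuous (η₂ ω) := by
    filter_upwards [hae] with ω ⟨_, _, ⟨e, he⟩, _⟩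
    have : η₂ ω = fun u ↦ γ ω ((e.symm u : ℝ≥0) : ℝ) := by
      funext u
      rw [he, OrderIso.apply_symm_apply]
    rw [this]
    exact (γ ω).continuous.comp (NNReal.continuous_coe.comp e.symm.continuous)
  refine ⟨Ω, ‹_›, P, _, _, fun ω ↦ dilatePath ν a (γ ω), hpair.const_mul hcont hsph hc,
    (measurable_dilatePath ν a).comp hγ, Measure.map_map (measurable_dilatePath ν a) hγ, ?_⟩
  filter_upwards [hae] with ω hω
  exact natParamClause_dilatePath hνd ha (Real.log c) hω

end Closure

end Literature.Probability.RandomPlanarGeometry
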